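import Literature.AlgebraicGeometry.Frobenioids.ArithmeticFrobenioidThm64ivSolitary
import HarnessLib

/-!
# Frobenioids I, Theorem 6.4 (iv), second clause when `Gal(L₁/F₁)` is a SYLOW subgroup of `Gal(L₁/ℚ)`
# (GAP-LEDGER G-L1t3-1 #2, continued: a class of non-Galois base fields of arbitrary degree)

Mochizuki, *The geometry of Frobenioids I: the general theory*, Kyushu J. Math. **62** (2008) 293–400, §6,
Thm. 6.4 (iv) p. 115 l. 23–29 [cite: MochizukiFrdI2008, Thm. 6.4 (iv) p.115]; R. Perlis, *On the equation
`ζ_K(s) = ζ_{K'}(s)`*, J. Number Theory **9** (1977), Thm. 1 (d) [cite: Perlis1977, Thm. 1 (p. 345)].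

PROOF-ONLY file (cell abc-iut, layer L1; seat abc-iut-w4-d090 gen 5; 0 definitions). By
`ArithmeticFrobenioidThm64ivSolitary.lean` the Cor. 4.11 (iv) datum of an equivalence `Ψ : C_{K₁/F₁} ⥲ C_{K₂/F₂}`
of THE arithmetic Frobenioids makes the base fields arithmetically equivalent, hence (Perlis' Theorem 1 (d),
kernel-proved) their fixing subgroups in any common Galois number field GASSMANN EQUIVALENT. Gassmann-equivalent
subgroups have the same order; if that order is the full `p`-part of the order of the Galois group they are Sylow
`p`-subgroups, hence CONJUGATE (Sylow's second theorem, Mathlib), and conjugate subgroups cut out isomorphic fixed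
fields. Whence:

* `algEquiv_of_isGassmannEquivalent_of_sylow` (pure number theory) — number fields `K, K'` embedded in a Galois
  number field `N` with Gassmann-equivalent fixing subgroups, one of which is a Sylow subgroup of `Gal(N/ℚ)`, are
  isomorphic;
* `Thm64iv_arith_compat_of_sylow` — **the printed clause of Thm. 6.4 (iv) at the constructions whenever some
  `X = Spec L₁`, `L₁` Galois over `ℚ`, has `[L₁ : ℚ] = p^k · [F₁ : ℚ]` with `p ∤ [F₁ : ℚ]`** (i.e. `Gal(L₁/F₁)` is a
  Sylow `p`-subgroup of `Gal(L₁/ℚ)`; e.g. every non-Galois cubic `F₁` with `L₁` its `S₃`-closure, or any `F₁` of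
  degree prime to `p` under a Galois `p`-power extension), together with `F₁ ≅ F₂`
  (`nonempty_baseRingEquiv_arith_of_sylow`).
Nothing here bears on, or takes a side on, [IUTchIII] Cor. 3.12.
-/

noncomputable section

namespace Literature.AlgebraicGeometry.Frobenioids

open CategoryTheory Opposite NumberField
open Literature.NumberTheory.NumberFields
open scoped Pointwise

/-! ### Gassmann-equivalent Sylow subgroups cut out isomorphic fields -/

section Sylow

variable {N : Type} [Field N] [NumberField N] [IsGalois ℚ N]
  {K K' : Type} [Field K] [NumberField K] [Field K'] [NumberField K']

/-- **Gassmann-equivalent subgroups of Sylow order are conjugate, so their fixed fields are isomorphic**: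
for `ℚ`-embeddings `i : K → N`, `i' : K' → N` into a Galois number field with `Gal(N/i K)`, `Gal(N/i' K')`
Gassmann equivalent (Perlis' condition (d)) and `#Gal(N/i K) = p^{v_p(#Gal(N/ℚ))}`, `K ≃ K'` over `ℚ`
(Sylow's second theorem; `L^{gHg⁻¹} = g(L^H)`). [cite: Perlis1977, Thm. 1 (p. 345)] -/
theorem algEquiv_of_isGassmannEquivalent_of_sylow (i : K →ₐ[ℚ] N) (i' : K' →ₐ[ℚ] N)
    (hG : IsGassmannEquivalent i.fieldRange.fixingSubgroup i'.fieldRange.fixingSubgroup)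
    {p : ℕ} (hp : p.Prime)
    (hcard : Nat.card i.fieldRange.fixingSubgroup = p ^ (Nat.card (N ≃ₐ[ℚ] N)).factorization p) :
    Nonempty (K ≃ₐ[ℚ] K') := by
  haveI : Fact p.Prime := ⟨hp⟩
  set E : IntermediateField ℚ N := i.fieldRange with hE
  set E' : IntermediateField ℚ N := i'.fieldRange with hE'
  have hcard' : Nat.card E'.fixingSubgroup = p ^ (Nat.card (N ≃ₐ[ℚ] N)).factorization p := by
    rw [← hG.card_eq]
    exact hcard
  let P : Sylow p (N ≃ₐ[ℚ] N) := Sylow.ofCard E.fixingSubgroup hcard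
  let P' : Sylow p (N ≃ₐ[ℚ] N) := Sylow.ofCard E'.fixingSubgroup hcard'
  obtain ⟨g, hg⟩ := MulAction.exists_smul_eq (N ≃ₐ[ℚ] N) P P'
  have hconj : E'.fixingSubgroup = E.fixingSubgroup.map (MulAut.conj g).toMonoidHom := by
    have h : ((g • P : Sylow p (N ≃ₐ[ℚ] N)) : Subgroup (N ≃ₐ[ℚ] N)) = (P' : Subgroup (N ≃ₐ[ℚ] N)) :=
      congrArg (fun Q : Sylow p (N ≃ₐ[ℚ] N) => (Q : Subgroup (N ≃ₐ[ℚ] N))) hg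
    rw [Sylow.coe_subgroup_smul] at h
    change MulAut.conj g • E.fixingSubgroup = E'.fixingSubgroup at h
    rw [← h]
    rfl
  have hfix : E' = E.map (g : N →ₐ[ℚ] N) := by
    rw [← IsGalois.fixedField_fixingSubgroup E', hconj, fixedField_map_conj, IsGalois.fixedField_fixingSubgroup]
  exact ⟨(i.equivFieldRange.trans ((IntermediateField.equivMap E (g : N →ₐ[ℚ] N)).trans
    (IntermediateField.equivOfEq hfix.symm))).trans i'.equivFieldRange.symm⟩

/-- Bookkeeping: `#Gal(N/i K)` is the full `p`-part of `#Gal(N/ℚ)` as soon as `[N : ℚ] = p^k · [K : ℚ]` with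
`p ∤ [K : ℚ]`. [folklore] -/
private theorem card_fixingSubgroup_fieldRange_eq_pow (i : K →ₐ[ℚ] N) {p k : ℕ} (hp : p.Prime)
    (hdeg : Module.finrank ℚ N = p ^ k * Module.finrank ℚ K) (hcop : ¬ p ∣ Module.finrank ℚ K) :
    Nat.card i.fieldRange.fixingSubgroup = p ^ (Nat.card (N ≃ₐ[ℚ] N)).factorization p := by
  have hKpos : 0 < Module.finrank ℚ K := by
    rw [i.equivFieldRange.toLinearEquiv.finrank_eq]
    exact Module.finrank_pos
  have h1 : Nat.card i.fieldRange.fixingSubgroup = p ^ k := by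
    rw [IsGalois.card_fixingSubgroup_eq_finrank i.fieldRange]
    have htower := Module.finrank_mul_finrank ℚ i.fieldRange N
    rw [← i.equivFieldRange.toLinearEquiv.finrank_eq, hdeg, mul_comm (p ^ k)] at htower
    exact Nat.eq_of_mul_eq_mul_left hKpos htower
  have h2 : (Nat.card (N ≃ₐ[ℚ] N)).factorization p = k := by
    rw [IsGalois.card_aut_eq_finrank, hdeg, Nat.factorization_mul (pow_ne_zero _ hp.ne_zero) hKpos.ne',
      Finsupp.add_apply, Nat.Prime.factorization_pow hp, Finsupp.single_eq_same,
      Nat.factorization_eq_zero_of_not_dvd hcop, add_zero]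
  rw [h1, h2]

end Sylow

/-! ### At the arithmetic Frobenioids -/

section Arith

variable {F₁ : Type} [Field F₁] [NumberField F₁] {K₁ : Type} [Field K₁] [Algebra F₁ K₁] [IsGalois F₁ K₁]
variable {F₂ : Type} [Field F₂] [NumberField F₂] {K₂ : Type} [Field K₂] [Algebra F₂ K₂] [IsGalois F₂ K₂]

/-- **`F₁ ≅ F₂` in the SYLOW CASE.** For an equivalence `Ψ : C_{K₁/F₁} ⥲ C_{K₂/F₂}` of arithmetic Frobenioids with
Cor. 4.11 (iv) datum, `B₁ = Spec F₁`, and some `X = Spec L₁` with `L₁` Galois over `ℚ` and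
`[L₁ : ℚ] = p^k · [F₁ : ℚ]`, `p ∤ [F₁ : ℚ]`: then `F₁ ≅ F₂`. Route: `L₁ ≅ L₂ := (Ψ^Base X).L` (T64iv/L07a,
abc-iut-L1-d7's `Thm64iv_arith_fieldIso`), so `F₁` and `F₂` both embed in `L₁`; their fixing subgroups are Gassmann
equivalent (`arith_base_isGassmannEquivalent`) and the first is a Sylow `p`-subgroup of `Gal(L₁/ℚ)`.
[cite: MochizukiFrdI2008, Thm. 6.4 (iv) p.115] -/
theorem nonempty_baseRingEquiv_arith_of_sylow (Ψ : arithFrobenioid F₁ K₁ ≌ arithFrobenioid F₂ K₂)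
    {ΨBase : FinSubextCat F₁ K₁ ⥤ FinSubextCat F₂ K₂} [ΨBase.IsEquivalence]
    (E : PreFrobenioidData.DivisorMonoidIsoOverBase (arithFrobenioidOps F₁ K₁) (arithFrobenioidOps F₂ K₂) ΨBase)
    (η : Ψ.functor ⋙ (arithFrobenioidOps F₂ K₂).base ≅ (arithFrobenioidOps F₁ K₁).base ⋙ ΨBase)
    (hdiv : ∀ ⦃A B : arithFrobenioid F₁ K₁⦄ (φ : A ⟶ B),
      (arithFrobenioidOps F₂ K₂).div (Ψ.functor.map φ) =
        (arithFrobenioidOps F₂ K₂).pull (η.hom.app A)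
          (E.iso ((arithFrobenioidOps F₁ K₁).base.obj A) ((arithFrobenioidOps F₁ K₁).div φ)))
    (B₁ : FinSubextCat F₁ K₁) (ε₁ : B₁.L ≃ₐ[F₁] F₁) (X : FinSubextCat F₁ K₁) (hX : IsGalois ℚ X.L)
    {p k : ℕ} (hp : p.Prime) (hdeg : Module.finrank ℚ X.L = p ^ k * Module.finrank ℚ F₁)
    (hcop : ¬ p ∣ Module.finrank ℚ F₁) : Nonempty (F₁ ≃+* F₂) := by
  haveI := hX
  obtain ⟨e⟩ := Thm64iv_arith_fieldIso Ψ E η hdiv X hX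
  let i : F₁ →ₐ[ℚ] X.L := (algebraMap F₁ X.L).toRatAlgHom
  let i' : F₂ →ₐ[ℚ] X.L := (e.symm.toRingHom.comp (algebraMap F₂ (ΨBase.obj X).L)).toRatAlgHom
  have hG := arith_base_isGassmannEquivalent Ψ E η hdiv B₁ ε₁ X.L i i'
  obtain ⟨φ⟩ := algEquiv_of_isGassmannEquivalent_of_sylow i i' hG hp
    (card_fixingSubgroup_fieldRange_eq_pow i hp hdeg hcop)
  exact ⟨φ.toRingEquiv⟩

/-- **[FrdI] Thm. 6.4 (iv), second clause IN FULL at the constructions, SYLOW CASE**: with the hypotheses of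
`nonempty_baseRingEquiv_arith_of_sylow`, at EVERY `X' = Spec L₁'` with `L₁'` Galois over `ℚ` the field
`(Ψ^Base X').L` is isomorphic to `L₁'` compatibly with an isomorphism `F₁ ≅ F₂`.
[cite: MochizukiFrdI2008, Thm. 6.4 (iv) p.115] -/
theorem Thm64iv_arith_compat_of_sylow (Ψ : arithFrobenioid F₁ K₁ ≌ arithFrobenioid F₂ K₂)
    {ΨBase : FinSubextCat F₁ K₁ ⥤ FinSubextCat F₂ K₂} [ΨBase.IsEquivalence]
    (E : PreFrobenioidData.DivisorMonoidIsoOverBase (arithFrobenioidOps F₁ K₁) (arithFrobenioidOps F₂ K₂) ΨBase)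
    (η : Ψ.functor ⋙ (arithFrobenioidOps F₂ K₂).base ≅ (arithFrobenioidOps F₁ K₁).base ⋙ ΨBase)
    (hdiv : ∀ ⦃A B : arithFrobenioid F₁ K₁⦄ (φ : A ⟶ B),
      (arithFrobenioidOps F₂ K₂).div (Ψ.functor.map φ) =
        (arithFrobenioidOps F₂ K₂).pull (η.hom.app A)
          (E.iso ((arithFrobenioidOps F₁ K₁).base.obj A) ((arithFrobenioidOps F₁ K₁).div φ)))
    (B₁ : FinSubextCat F₁ K₁) (ε₁ : B₁.L ≃ₐ[F₁] F₁) (X : FinSubextCat F₁ K₁) (hX : IsGalois ℚ X.L)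
    {p k : ℕ} (hp : p.Prime) (hdeg : Module.finrank ℚ X.L = p ^ k * Module.finrank ℚ F₁)
    (hcop : ¬ p ∣ Module.finrank ℚ F₁) (X' : FinSubextCat F₁ K₁) (hX' : IsGalois ℚ X'.L) :
    ∃ (e : X'.L ≃+* (ΨBase.obj X').L) (e₀ : F₁ ≃+* F₂),
      ∀ a : F₁, e (algebraMap F₁ X'.L a) = algebraMap F₂ (ΨBase.obj X').L (e₀ a) := by
  obtain ⟨φ⟩ := nonempty_baseRingEquiv_arith_of_sylow Ψ E η hdiv B₁ ε₁ X hX hp hdeg hcop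
  exact Thm64iv_arith_compat_of_baseIso Ψ E η hdiv φ X' hX'

end Arith

end Literature.AlgebraicGeometry.Frobenioids

end
-- enqueue re-land 2026-08-26T09:27:20Z (abc-iut-L1-d6 g3, RQ7 reader of the deferred child p433079): comment-only, declarations byte-identical to p431747; purpose = re-dispatch the stranded olean build («stale:362:unbuilt» at 09:2xZ, 85 min after accept)
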